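import Summits.HodgeConjecture.HodgeConjecture.Theorems.R90S2ArchCuspPinDefs            -- ★ p864254 FILE 1 (S2-R13 «E»): `IsArchTraceCuspidal`, `IsSquareIntegrableRep`, `isDiscreteSeriesRep_iff_isSquareIntegrableRep`, `CuspG₀`, `embPlace`
import Literature.NumberTheory.Automorphic.UnitaryGlobalizationIrreducibleNoAdm            -- ★ `isTopIrreducible_of_isUnitaryGlobalization` (a unitary globalization of an irreducible `(𝔤,K)`-class is irreducible)
import HarnessLib

/-!
# R90 · S2-R13 «E» — FILE 1b: the cusp pin PAYS ★ (O-rep) — `IsArchTraceCuspidal fτ → IsLocDSOrthogonal H τc T hT ν fτ`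

Cell `hodgecm-mathlib`, round R90, section S2 «Ch11-arch» (base C11); HOME pre-type by R90-C11-typ1 (g3) on the S2 dealer's
word W14 (K2E1b-plan (g8), 2026-09-05T01:44:12Z; HEADS `S2-R13-E-SOURCE-SOCKETS-HEADS.v1` 41f963bf §1 (P5), C4∕C5).
THEOREMS ONLY (no `def`, no instance, no notation, no `sorry`); namespace `Summit.HodgeConjecture.HodgeConjecture.R90.S2`.

## What this file proves

FILE 1 (★ `R90S2ArchCuspPinDefs`) pinned local cuspidality SPECTRALLY and family-free: `IsArchTraceCuspidal fτ` := for every Haar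
measure and every IRREDUCIBLE unitary representation `ϖ` of the local group that is not square-integrable, `tr ϖ(fτ) = 0`.  The older
★ currency (O-rep) `IsLocDSOrthogonal H τc T hT ν fτ` (★ `R90S2ArchLocalCuspidalDefs` §3) asks the same vanishing for every unitary
GLOBALIZATION `ϖ` of a `(𝔤,K)`-class of E1b's `U(2,1)` that is tempered and not discrete series, on the frame transport
`ccTransport (locFrame H τc T hT) fτ`.  The bridge (P5 of the heads)

* `isLocDSOrthogonal_of_isArchTraceCuspidal : IsArchTraceCuspidal fτ → IsLocDSOrthogonal H τc T hT ν fτ` (every Haar `ν`)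

is UNCONDITIONAL: the irreducibility of unitary globalizations (C4 of the heads) is the ★ Literature theorem
`isTopIrreducible_of_isUnitaryGlobalization` (Knapp–Vogan Thm. 0.4 reading, `UnitaryGlobalizationIrreducibleNoAdm`), and the Haar ∕
representation transport along the local frame `locFrame H τc T hT : U(σ_τc H)(ℂ) ≃ₜ* U(2,1)` (C5) is §1 below.  Consequently every ★
two-place glue over (O-rep) (★ `R90S2ArchLocalDSClassBridge`, ★ `R90S2ArchLocalCuspidalLemmas` §1) applies BY NAME to a test function carrying
the FILE 1 pin, in ANY unitary frame `(T, hT)`.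

## Contents

* §1 TRANSPORT along a surjective hom ∕ a topological-group isomorphism `e : G' ≃ₜ* G` (general; reusable by the S10∕S7 frames):
  `isTopIrreducible_restrict_of_surjective` (Mathlib `ContRepresentation.restrict`; closed invariant subspaces of `π ∘ φ` and `π` coincide when `φ`
  is onto; unitarity ∕ strong continuity of the pull-back are ★ `ContRepresentation.IsUnitary.restrict` ∕ `.IsStronglyContinuous.restrict`), `integratedOperator_restrict_map`
  (`(π ∘ e)(f) dν∘e = π(f ∘ e⁻¹) dν`, Bochner change of variables along the homeomorphism), `isSquareIntegrableRep_restrict_map_iff`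
  (matrix coefficients are `L²(ν∘e)` iff `L²(ν)`), `hasArchOpTrace_restrict_map_iff` (operator traces agree).
* §2 THE BRIDGE `isLocDSOrthogonal_of_isArchTraceCuspidal` and its reading at the pin of record:
  `CuspG₀.exists_isLocDSOrthogonal` — a `CuspG₀`-cuspidal `f` factors at the embedding place with a local factor that is (O-rep) in every frame.

NOT HERE: the converse (O-rep) ⇒ pin (it would need «every irreducible unitary non-square-integrable `ϖ'` of `U(σ_τc H)(ℂ)` is a globalization of
a tempered-or-not class» — the admissibility∕Harish-Chandra-module direction, E1b's lane); any construction of a cuspidal test function (T2 debt).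

References: Rogawski (1990) §12.3, Props. 12.3.2–12.3.3 (the trace condition), §14.4 (local frames), proof of Thm. 14.6.1 p. 241; Clozel–Delorme, Invent.
Math. 77 (1984) Thm. 1 and Ann. Sci. ÉNS 23 (1990) Prop. 4, Cor. (pseudo-coefficients); Knapp–Vogan (1995) Thm. 0.4 (globalizations);
Deitmar–Echterhoff (2014) Prop. 6.2.1 (integrated operators); Folland (1995) §2.2 (Haar measure under isomorphisms).

HONEST LABEL: HC_CM is proved only modulo the 7 printed citations (2 remaining named inputs: hLiu418 = stmt-HodgeConjecture-24832,
h413 = stmt-HodgeConjecture-24833) until rung 0 closes.  This file moves the pin's currency onto ★ (O-rep); it constructs no test function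
and shows none cuspidal.  0 proposals ∕ 0 crux writes ∕ 0 registry acts by the typing seat.
-/

set_option autoImplicit false
set_option linter.dupNamespace false

noncomputable section

open MeasureTheory NumberField NumberField.InfinitePlace CompactlySupported
open scoped Matrix MatrixGroups InnerProductSpace
open Literature.NumberTheory.Automorphic Literature.NumberTheory.Automorphic.UnitaryGroup
open Literature.RepresentationTheory.KonnoKonno2007 Literature.RepresentationTheory.KonnoKonno2007.RealDualPair
open Summit.HodgeConjecture.HodgeConjecture.Cruxes.H413.K2E1bGKCohomologyU21.U8 (IsDiscreteSeriesRep IsTemperedRep HasArchOpTrace hasArchOpTrace_iff)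
open Summit.HodgeConjecture.HodgeConjecture.R90.S10 (phi3 GInf GArch ArchOrbFamG)

namespace Summit.HodgeConjecture.HodgeConjecture.R90.S2

/-! ## §1 Transport of representations, integrated operators and traces along `φ : G' →* G` ∕ `e : G' ≃ₜ* G` -/

section Transport

variable {G G' : Type*} [Group G] [Group G'] [TopologicalSpace G] [TopologicalSpace G']
  {E : Type} [NormedAddCommGroup E] [InnerProductSpace ℂ E] [CompleteSpace E]

omit [TopologicalSpace G] [TopologicalSpace G'] [CompleteSpace E] in
/-- **Irreducibility pulls back along a SURJECTIVE hom**: the closed `π ∘ φ`-invariant subspaces are exactly the closed `π`-invariant ones.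
(cf. ★ `Literature.NumberTheory.Automorphic.isTopIrreducible_restrict_iff_of_surjective` (`CuspidalTypeOfResidual`) and ★
`Literature.NumberTheory.Rogawski1990.isTopIrreducible_restrict_of_surjective` (`ArchCharactersRealCase`) — same statement, neither one inside
the closure of this file's imports (probe: unknown identifier over FILE 1 + `UnitaryGlobalizationIrreducibleNoAdm`); re-proved in 15 lines rather
than importing the GL-type ∕ T1-engine cones.) [cite: Dixmier1977, §13.1.5] [cite: JacquetLanglands1970, §16, Lemma 16.1.1 (proof) p. 498] -/
theorem isTopIrreducible_restrict_of_surjective (π : ContRepresentation ℂ G E) (φ : G' →* G) (hφ : Function.Surjective φ)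
    (h : π.IsTopIrreducible) : (π.restrict φ).IsTopIrreducible := by
  rw [ContRepresentation.isTopIrreducible_iff] at h ⊢
  refine ⟨h.1, fun W => ?_⟩
  let W' : ContRepresentation.ClosedSubrep π :=
    { toSubmodule := W.toSubmodule
      apply_mem_toSubmodule := fun g v hv => by
        obtain ⟨g', rfl⟩ := hφ g
        exact W.apply_mem_toSubmodule g' hv
      isClosed' := W.isClosed' }
  rcases h.2 W' with hW | hW
  · refine Or.inl (ContRepresentation.ClosedSubrep.ext fun v => ?_)
    have hv := ContRepresentation.ClosedSubrep.ext_iff.mp hW v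
    rw [ContRepresentation.ClosedSubrep.mem_bot] at hv ⊢
    exact hv
  · refine Or.inr (ContRepresentation.ClosedSubrep.ext fun v => ?_)
    have hv := ContRepresentation.ClosedSubrep.ext_iff.mp hW v
    simp only [ContRepresentation.ClosedSubrep.mem_top, iff_true] at hv ⊢
    exact hv

variable [MeasurableSpace G] [BorelSpace G] [MeasurableSpace G'] [BorelSpace G']

/-- **Integrated operators under a topological-group isomorphism** `e : G' ≃ₜ* G`: `(π ∘ e)(f)` computed against the pulled-back measure
`ν ∘ e` (= `ν.map e⁻¹`) is `π(f ∘ e⁻¹)` computed against `ν` — Bochner change of variables along the homeomorphism.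
[cite: DeitmarEchterhoff2014, Prop. 6.2.1] [cite: Folland1995, §2.2] -/
theorem integratedOperator_restrict_map (π : ContRepresentation ℂ G E) (e : G' ≃ₜ* G) (hu : π.IsUnitary) (hsc : π.IsStronglyContinuous)
    (ν : Measure G) [IsFiniteMeasureOnCompacts ν] [IsFiniteMeasureOnCompacts (ν.map e.symm)] (f : C_c(G', ℂ)) :
    (π.restrict e.toMulEquiv.toMonoidHom).integratedOperator (hu.restrict _) (hsc.restrict _ e.continuous) (ν.map e.symm) f =
      π.integratedOperator hu hsc ν (ccTransport e.toHomeomorph f) := by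
  ext v
  rw [ContRepresentation.integratedOperator_apply, ContRepresentation.integratedOperator_apply]
  have hme : MeasurableEmbedding (e.symm : G → G') := e.symm.toHomeomorph.measurableEmbedding
  rw [hme.integral_map]
  congr 1
  funext g
  show f (e.symm g) • π (e (e.symm g)) v = f (e.symm g) • π g v
  rw [ContinuousMulEquiv.apply_symm_apply]

/-- **Square-integrability transports**: the matrix coefficients of `π ∘ e` are `L²(ν ∘ e)` iff those of `π` are `L²(ν)`. [cite: Folland1995, §2.2] -/
theorem isSquareIntegrableRep_restrict_map_iff (π : ContRepresentation ℂ G E) (e : G' ≃ₜ* G) (ν : Measure G) :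
    IsSquareIntegrableRep (ν.map e.symm) (π.restrict e.toMulEquiv.toMonoidHom) ↔ IsSquareIntegrableRep ν π := by
  have hme : MeasurableEmbedding (e.symm : G → G') := e.symm.toHomeomorph.measurableEmbedding
  refine forall₂_congr fun v w => ?_
  rw [hme.memLp_map_measure_iff]
  exact Iff.of_eq (congrArg (fun F : G → ℂ => MemLp F 2 ν) (funext fun g => by
    show ⟪v, π (e (e.symm g)) w⟫_ℂ = ⟪v, π g w⟫_ℂ
    rw [ContinuousMulEquiv.apply_symm_apply]))

/-- **Operator traces transport**: `tr (π ∘ e)(f) dν∘e = c ↔ tr π(f ∘ e⁻¹) dν = c` (same operator by `integratedOperator_restrict_map`).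
[cite: DeitmarEchterhoff2014, Prop. 6.2.1] -/
theorem hasArchOpTrace_restrict_map_iff (π : ContRepresentation ℂ G E) (e : G' ≃ₜ* G) (hu : π.IsUnitary) (hsc : π.IsStronglyContinuous)
    (ν : Measure G) [IsFiniteMeasureOnCompacts ν] [IsFiniteMeasureOnCompacts (ν.map e.symm)] (f : C_c(G', ℂ)) (c : ℂ) :
    HasArchOpTrace (ν.map e.symm) (π.restrict e.toMulEquiv.toMonoidHom) (hu.restrict _) (hsc.restrict _ e.continuous) f c ↔
      HasArchOpTrace ν π hu hsc (ccTransport e.toHomeomorph f) c := by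
  rw [hasArchOpTrace_iff, hasArchOpTrace_iff, integratedOperator_restrict_map π e hu hsc ν f]

end Transport

/-! ## §2 The bridge: the FILE 1 pin pays ★ (O-rep) in every unitary frame -/

section Bridge

variable {L : Type} [Field L] [NumberField L] [IsCMField L]
  (H : Matrix (Fin 3) (Fin 3) L) (τc : {w : InfinitePlace L // w.IsComplex}) (T : GL (Fin 3) ℂ)
  (hT : (T : Matrix (Fin 3) (Fin 3) ℂ)ᴴ * H.map τc.1.embedding * (T : Matrix (Fin 3) (Fin 3) ℂ) =
    Literature.Geometry.ComplexHyperbolic.BallModel.J)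

omit [NumberField L] [IsCMField L] in
/-- **(P5) THE CUSP PIN PAYS (O-rep).**  If `fτ ∈ C_c(U(σ_τc H)(ℂ))` has trace `0` in every irreducible unitary non-square-integrable
representation (★ `IsArchTraceCuspidal`, all Haar measures), then for every Haar measure `ν` on E1b's `U(2,1)` and every unitary frame
`(T, hT)` its transport is (O-rep): trace `0` in every tempered non-discrete-series unitary globalization (★ `IsLocDSOrthogonal`).
Proof: pull the globalization `ϖ` back along ★ `locFrame H τc T hT`; it stays unitary, strongly continuous and — by ★
`isTopIrreducible_of_isUnitaryGlobalization` and §1 — irreducible; it is not square-integrable for `ν ∘ e` because `ϖ` is not discrete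
series for `ν` with the other three conjuncts of ★ `IsDiscreteSeriesRep` in hand; the pin at the Haar measure `ν ∘ e` gives trace `0`, and
§1 identifies the two operators.  (The tempered hypothesis of (O-rep) is not used.) [cite: Rogawski1990, §12.3 Prop. 12.3.3] [cite: Rogawski1990, Thm. 14.6.1 (proof, p. 241)]
[cite: ClozelDelorme1990, Prop. 4, Corollaire] [cite: KnappVogan1995, Thm. 0.4] -/
theorem isLocDSOrthogonal_of_isArchTraceCuspidal
    [MeasurableSpace ↥(uFormGroup (Fin 2) (Fin 1)).carrier] [BorelSpace ↥(uFormGroup (Fin 2) (Fin 1)).carrier]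
    (ν : Measure ↥(uFormGroup (Fin 2) (Fin 1)).carrier) [ν.IsHaarMeasure]
    {fτ : C_c(↥(archLocal L 3 H τc), ℂ)} (h : IsArchTraceCuspidal fτ) : IsLocDSOrthogonal H τc T hT ν fτ := by
  intro x E _ _ _ ϖ hϖ _ hnds
  letI : MeasurableSpace ↥(archLocal L 3 H τc) := borel _
  haveI : BorelSpace ↥(archLocal L 3 H τc) := ⟨rfl⟩
  have hirr : ϖ.IsTopIrreducible := isTopIrreducible_of_isUnitaryGlobalization x hϖ
  have hirr' : (ϖ.restrict (locFrame H τc T hT).toMulEquiv.toMonoidHom).IsTopIrreducible :=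
    isTopIrreducible_restrict_of_surjective ϖ _ (locFrame H τc T hT).surjective hirr
  have hnsq : ¬ IsSquareIntegrableRep (ν.map (locFrame H τc T hT).symm) (ϖ.restrict (locFrame H τc T hT).toMulEquiv.toMonoidHom) :=
    fun hsq => hnds ((isDiscreteSeriesRep_iff_isSquareIntegrableRep (uFormGroup (Fin 2) (Fin 1)) ν ϖ).mpr
      ⟨hϖ.isUnitary, hϖ.isStronglyContinuous, hirr, (isSquareIntegrableRep_restrict_map_iff ϖ (locFrame H τc T hT) ν).mp hsq⟩)
  have h0 := (isArchTraceCuspidal_iff fτ).mp h (ν.map (locFrame H τc T hT).symm) E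
    (ϖ.restrict (locFrame H τc T hT).toMulEquiv.toMonoidHom) (hϖ.isUnitary.restrict _)
    (hϖ.isStronglyContinuous.restrict _ (locFrame H τc T hT).continuous) hirr' hnsq
  exact (hasArchOpTrace_restrict_map_iff ϖ (locFrame H τc T hT) hϖ.isUnitary hϖ.isStronglyContinuous ν fτ 0).mp h0

/-- **The pin of record pays (O-rep) at the embedding place, in every frame.**  A `CuspG₀`-cuspidal `f` on `U(Φ₃)_∞` factors at
`embPlace L ι` with a local factor `fτ` that is (O-rep) for every Haar `ν` and every unitary frame `(T, hT)` of `σ_{mk ι} Φ₃`.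
[cite: Rogawski1990, §12.3 Prop. 12.3.3] [cite: Rogawski1990, §14.4] -/
theorem CuspG₀.exists_isLocDSOrthogonal {m : ArchOrbFamG L} {ι : L →+* ℂ} {f : GArch L → ℂ} (hf : CuspG₀ L m ι f)
    [MeasurableSpace ↥(uFormGroup (Fin 2) (Fin 1)).carrier] [BorelSpace ↥(uFormGroup (Fin 2) (Fin 1)).carrier] :
    ∃ (fτ : C_c(↥(archLocal L 3 (phi3 L) (embPlace L ι)), ℂ))
      (fc : (∀ w' : {w' : {w : InfinitePlace L // w.IsComplex} // w' ≠ embPlace L ι}, ↥(archLocal L 3 (phi3 L) w'.1)) → ℂ),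
      IsArchFactoredAtPlace (phi3 L) (embPlace L ι) f ⇑fτ fc ∧
        ∀ (T : GL (Fin 3) ℂ)
          (hT : (T : Matrix (Fin 3) (Fin 3) ℂ)ᴴ * (phi3 L).map (embPlace L ι).1.embedding * (T : Matrix (Fin 3) (Fin 3) ℂ) =
            Literature.Geometry.ComplexHyperbolic.BallModel.J)
          (ν : Measure ↥(uFormGroup (Fin 2) (Fin 1)).carrier) [ν.IsHaarMeasure],
          IsLocDSOrthogonal (phi3 L) (embPlace L ι) T hT ν fτ := by
  obtain ⟨fτ, fc, hfac, hcusp⟩ := hf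
  exact ⟨fτ, fc, hfac, fun T hT ν _ => isLocDSOrthogonal_of_isArchTraceCuspidal (phi3 L) (embPlace L ι) T hT ν hcusp⟩

end Bridge

end Summit.HodgeConjecture.HodgeConjecture.R90.S2
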